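import Summits.NavierStokesRegularity.NavierStokesRegularity.Theses.LevelSetModeration
import Summits.NavierStokesRegularity.NavierStokesRegularity.Theorems.LevelSetModerationLevelSetEnergyInequalityTruncation
import Literature.Analysis.FluidPDE.RapidDecayLemmas
import Literature.Analysis.FluidPDE.TaoEnstrophyLocalisation

/-!
# Route LevelSetModeration — `HighSpeedPressureWork`: time-measurability of the slice quantities

Support file for item stmt-NavierStokesRegularity-18149. The crux and every transfer argument
integrate SLICE quantities over `τ ∈ (0, t)`: the level-set dissipation slice
`B(τ) = ∫⁻ 1_{c<|u(τ)|} ofReal(|D|u(τ)||²)` and moderated pressure slices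
`A(τ) = ∫⁻ 1_{c<|u(τ)|} ofReal((q(τ) - Φ(τ,|u(τ)|))²)`. Cauchy–Schwarz in time
(`levelSetModeration_setIntegral_le_sqrt_mul_sqrt`) needs `A`, `B` a.e.-measurable on `(0, t)`.
For a jointly smooth velocity `u` on the slab `[0,T) × ℝ³` this is Tonelli
(`AEMeasurable.lintegral_prod_right'`) applied to a density on `ℝ × ℝ³` that is continuous on the
relatively open subset `{c < |u|}` of the slab (the speed gradient is
`|u|⁻¹⟨u, Du ·⟩` there, `Du(τ, x) = D(uncurry u)(τ, x) ∘ inr`), respectively a.e.-measurable.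

* `levelSetModeration_measurableSet_superlevel_slab` — `{(τ,x) ∈ [0,T) × ℝ³ | c < |u τ x|}` is measurable;
* `levelSetModeration_aemeasurable_dissipationSlice` — `τ ↦ B(τ)` is a.e.-measurable on `(0, t)`, `t ≤ T`;
* `levelSetModeration_aemeasurable_moderatedSlice` — `τ ↦ A(τ)` is a.e.-measurable on `(0, t)` for
  `q` jointly a.e.-measurable and `Φ` jointly continuous;
* `levelSetModeration_aemeasurable_pressure_sub` — `(τ, x) ↦ p τ x - C τ` is jointly a.e.-measurable for
  a jointly smooth `p` and measurable `C` (the normalised pressure, by Tao's normalisation lemma).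
-/

noncomputable section

-- single-conjunct summit: `Summit.<Summit>.<Problem>` repeats the name by the D-0017 layout
set_option linter.dupNamespace false

namespace Summit.NavierStokesRegularity.NavierStokesRegularity.Theorems

open MeasureTheory Set Filter Topology Function
open scoped ENNReal RealInnerProductSpace
open Literature.Analysis.FluidPDE

/-- The product of Lebesgue measure restricted to `(0, t)` with Lebesgue measure on `ℝ³` is the
restriction of the product measure to the slab `(0, t) × ℝ³`. [folklore] -/
theorem levelSetModeration_prod_restrict_Ioo (t : ℝ) :
    ((volume : Measure ℝ).restrict (Ioo 0 t)).prod (volume : Measure (EuclideanSpace ℝ (Fin 3))) =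
      ((volume : Measure ℝ).prod (volume : Measure (EuclideanSpace ℝ (Fin 3)))).restrict
        (Ioo 0 t ×ˢ univ) := by
  have h := Measure.prod_restrict (μ := (volume : Measure ℝ))
    (ν := (volume : Measure (EuclideanSpace ℝ (Fin 3)))) (Ioo 0 t) univ
  rwa [Measure.restrict_univ] at h

/-- **The super-level set of the speed inside the slab is measurable**: for `u` jointly continuous on
`[0, T) × ℝ³`, `{(τ, x) | τ ∈ [0, T), c < ‖u τ x‖}` is the intersection of the (measurable) slab with
an open set. [folklore] -/
theorem levelSetModeration_measurableSet_superlevel_slab {T : ℝ}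
    {u : ℝ → EuclideanSpace ℝ (Fin 3) → EuclideanSpace ℝ (Fin 3)}
    (hu : ContinuousOn (uncurry u) (Ico 0 T ×ˢ univ)) (c : ℝ) :
    MeasurableSet {z : ℝ × EuclideanSpace ℝ (Fin 3) | z ∈ Ico 0 T ×ˢ univ ∧ c < ‖uncurry u z‖} := by
  have hcont : ContinuousOn (fun z => ‖uncurry u z‖) (Ico 0 T ×ˢ univ) := hu.norm
  obtain ⟨O, hO, hOeq⟩ := (continuousOn_iff'.1 hcont) (Ioi c) isOpen_Ioi
  have hset : {z : ℝ × EuclideanSpace ℝ (Fin 3) | z ∈ Ico 0 T ×ˢ univ ∧ c < ‖uncurry u z‖} =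
      (fun z => ‖uncurry u z‖) ⁻¹' Ioi c ∩ Ico 0 T ×ˢ univ := by
    ext z
    simp only [mem_setOf_eq, mem_inter_iff, mem_preimage, mem_Ioi]
    tauto
  rw [hset, hOeq]
  exact hO.measurableSet.inter (measurableSet_Ico.prod MeasurableSet.univ)

/-- **Time-measurability of the level-set dissipation slice.** For a velocity field jointly smooth
on `[0, T) × ℝ³`, a level `c > 0` and `t ≤ T`, the slice
`τ ↦ ∫⁻ 1_{c<|u(τ)|} ofReal(‖D|u(τ)|‖²)` is a.e.-measurable on `(0, t)` (Tonelli for the density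
`1_W · ofReal(‖(|u|⁻¹⟨u,·⟩) ∘ D(uncurry u) ∘ inr‖²)`, continuous on the measurable set
`W = {c < |u|} ∩ slab`, which is the speed-gradient density by the chain rule). [folklore] -/
theorem levelSetModeration_aemeasurable_dissipationSlice {T : ℝ}
    {u : ℝ → EuclideanSpace ℝ (Fin 3) → EuclideanSpace ℝ (Fin 3)}
    (hu : IsSmoothSpaceTimeOn (Ico 0 T) u) {c : ℝ} (hc : 0 < c) {t : ℝ} (ht : t ≤ T) :
    AEMeasurable (fun τ => ∫⁻ x, {x | c < ‖u τ x‖}.indicator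
        (fun x => ENNReal.ofReal (‖fderiv ℝ (fun y => ‖u τ y‖) x‖ ^ 2)) x)
      (volume.restrict (Ioo 0 t)) := by
  rcases le_or_gt t 0 with ht0 | ht0
  · rw [Ioo_eq_empty (not_lt.2 ht0), Measure.restrict_empty]
    exact aemeasurable_zero_measure
  set Ω : Set (ℝ × EuclideanSpace ℝ (Fin 3)) := Ico 0 T ×ˢ univ with hΩ
  have hUΩ : UniqueDiffOn ℝ (Ico 0 T) := uniqueDiffOn_Ico 0 T
  set W : Set (ℝ × EuclideanSpace ℝ (Fin 3)) := {z | z ∈ Ω ∧ c < ‖uncurry u z‖} with hW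
  have hcontu : ContinuousOn (uncurry u) Ω := hu.continuousOn
  have hWmeas : MeasurableSet W := levelSetModeration_measurableSet_superlevel_slab hcontu c
  have hWΩ : W ⊆ Ω := fun z hz => hz.1
  -- the density
  set Dslab : ℝ × EuclideanSpace ℝ (Fin 3) → (ℝ × EuclideanSpace ℝ (Fin 3) →L[ℝ] EuclideanSpace ℝ (Fin 3)) :=
    fderivWithin ℝ (uncurry u) Ω with hDslab
  set G : ℝ × EuclideanSpace ℝ (Fin 3) → ℝ≥0∞ := fun z =>
    ENNReal.ofReal (‖(‖uncurry u z‖⁻¹ • innerSL ℝ (uncurry u z)).comp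
      ((Dslab z).comp (ContinuousLinearMap.inr ℝ ℝ (EuclideanSpace ℝ (Fin 3))))‖ ^ 2) with hG
  have hDcont : ContinuousOn Dslab Ω := (hu.contDiffOn_fderivWithin hUΩ).continuousOn
  have hGcont : ContinuousOn G W := by
    have hne : ∀ z ∈ W, ‖uncurry u z‖ ≠ 0 := fun z hz => (hc.trans hz.2).ne'
    have h1 : ContinuousOn (fun z => ‖uncurry u z‖⁻¹) W := (hcontu.mono hWΩ).norm.inv₀ hne
    have h2 : ContinuousOn (fun z => innerSL ℝ (uncurry u z)) W :=
      (innerSL ℝ).continuous.comp_continuousOn (hcontu.mono hWΩ)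
    have h3 : ContinuousOn (fun z => (Dslab z).comp
        (ContinuousLinearMap.inr ℝ ℝ (EuclideanSpace ℝ (Fin 3)))) W :=
      ((hDcont.mono hWΩ).clm_comp continuousOn_const)
    have h4 : ContinuousOn (fun z => (‖uncurry u z‖⁻¹ • innerSL ℝ (uncurry u z)).comp
        ((Dslab z).comp (ContinuousLinearMap.inr ℝ ℝ (EuclideanSpace ℝ (Fin 3))))) W :=
      (h1.smul h2).clm_comp h3
    exact ENNReal.continuous_ofReal.comp_continuousOn (h4.norm.pow 2)
  -- a.e.-measurability of the density for the product measure
  have hΨ : AEMeasurable (W.indicator G)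
      ((volume.restrict (Ioo 0 t)).prod (volume : Measure (EuclideanSpace ℝ (Fin 3)))) := by
    rw [aemeasurable_indicator_iff hWmeas]
    exact hGcont.aemeasurable hWmeas
  have hTon := hΨ.lintegral_prod_right'
  -- identification with the slice quantity for `τ ∈ (0, t)`
  refine hTon.congr ?_
  filter_upwards [ae_restrict_mem measurableSet_Ioo] with τ hτ
  have hτ' : τ ∈ Ico 0 T := ⟨hτ.1.le, hτ.2.trans_le ht⟩
  refine lintegral_congr fun x => ?_
  by_cases hx : c < ‖u τ x‖
  · have hzW : (τ, x) ∈ W := ⟨mk_mem_prod hτ' (mem_univ x), hx⟩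
    rw [indicator_of_mem hzW, indicator_of_mem (show x ∈ {x | c < ‖u τ x‖} from hx), hG]
    -- chain rule for the speed gradient at a point where `u τ x ≠ 0`
    have hx0 : u τ x ≠ 0 := by
      intro h0; rw [h0, norm_zero] at hx; exact absurd hx (not_lt.2 hc.le)
    have hdu : DifferentiableAt ℝ (u τ) x :=
      ((hu.contDiff_slice hτ').differentiable (by simp)) x
    have hchain : fderiv ℝ (fun y => ‖u τ y‖) x =
        (‖u τ x‖⁻¹ • innerSL ℝ (u τ x)).comp (fderiv ℝ (u τ) x) := by
      have h := (LevelSetEnergyInequality.hasFDerivAt_norm_of_ne_zero hx0).comp x hdu.hasFDerivAt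
      exact h.fderiv
    rw [hchain, hu.fderiv_slice_eq hτ' x]
    rfl
  · have hzW : (τ, x) ∉ W := fun h => hx h.2
    rw [indicator_of_notMem hzW, indicator_of_notMem (show x ∉ {x | c < ‖u τ x‖} from hx)]

/-- **Joint a.e.-measurability of a pressure minus a time-dependent constant.** For `p` jointly
smooth on `[0, T) × ℝ³`, `C : ℝ → ℝ` measurable and `t ≤ T`, the map `(τ, x) ↦ p τ x - C τ` is
a.e.-measurable for `dt|_{(0,t)} ⊗ dx` (the shape of the normalised pressure `p̃ = p - C(τ)` given
by Tao's normalisation lemma). [folklore] -/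
theorem levelSetModeration_aemeasurable_pressure_sub {T : ℝ}
    {p : ℝ → EuclideanSpace ℝ (Fin 3) → ℝ} (hp : IsSmoothSpaceTimeOn (Ico 0 T) p)
    {C : ℝ → ℝ} (hC : Measurable C) {t : ℝ} (ht : t ≤ T) :
    AEMeasurable (uncurry fun τ x => p τ x - C τ)
      ((volume.restrict (Ioo 0 t)).prod (volume : Measure (EuclideanSpace ℝ (Fin 3)))) := by
  have hsub : Ioo 0 t ×ˢ (univ : Set (EuclideanSpace ℝ (Fin 3))) ⊆ Ico 0 T ×ˢ univ :=
    prod_mono (fun τ hτ => ⟨hτ.1.le, hτ.2.trans_le ht⟩) Subset.rfl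
  have h1 : AEMeasurable (uncurry p)
      ((volume.restrict (Ioo 0 t)).prod (volume : Measure (EuclideanSpace ℝ (Fin 3)))) := by
    rw [levelSetModeration_prod_restrict_Ioo]
    exact (hp.continuousOn.mono hsub).aemeasurable (measurableSet_Ioo.prod MeasurableSet.univ)
  have h2 : AEMeasurable (fun z : ℝ × EuclideanSpace ℝ (Fin 3) => C z.1)
      ((volume.restrict (Ioo 0 t)).prod (volume : Measure (EuclideanSpace ℝ (Fin 3)))) :=
    (hC.comp measurable_fst).aemeasurable
  exact h1.sub h2

/-- **Time-measurability of a moderated pressure slice.** For `u` jointly smooth on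
`[0, T) × ℝ³`, `q : ℝ → ℝ³ → ℝ` jointly a.e.-measurable for `dt|_{(0,t)} ⊗ dx`, `Φ : ℝ → ℝ → ℝ`
jointly continuous and `t ≤ T`, the slice `τ ↦ ∫⁻ 1_{c<|u(τ)|} ofReal((q τ x - Φ τ |u τ x|)²)` is
a.e.-measurable on `(0, t)` (Tonelli). [folklore] -/
theorem levelSetModeration_aemeasurable_moderatedSlice {T : ℝ}
    {u : ℝ → EuclideanSpace ℝ (Fin 3) → EuclideanSpace ℝ (Fin 3)}
    (hu : IsSmoothSpaceTimeOn (Ico 0 T) u) (c : ℝ) {t : ℝ} (ht : t ≤ T)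
    {q : ℝ → EuclideanSpace ℝ (Fin 3) → ℝ}
    (hq : AEMeasurable (uncurry q)
      ((volume.restrict (Ioo 0 t)).prod (volume : Measure (EuclideanSpace ℝ (Fin 3)))))
    {Φ : ℝ → ℝ → ℝ} (hΦ : Continuous (uncurry Φ)) :
    AEMeasurable (fun τ => ∫⁻ x, {x | c < ‖u τ x‖}.indicator
        (fun x => ENNReal.ofReal ((q τ x - Φ τ ‖u τ x‖) ^ 2)) x)
      (volume.restrict (Ioo 0 t)) := by
  set Ω : Set (ℝ × EuclideanSpace ℝ (Fin 3)) := Ico 0 T ×ˢ univ with hΩ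
  set W : Set (ℝ × EuclideanSpace ℝ (Fin 3)) := {z | z ∈ Ω ∧ c < ‖uncurry u z‖} with hW
  have hcontu : ContinuousOn (uncurry u) Ω := hu.continuousOn
  have hWmeas : MeasurableSet W := levelSetModeration_measurableSet_superlevel_slab hcontu c
  have hsub : Ioo 0 t ×ˢ (univ : Set (EuclideanSpace ℝ (Fin 3))) ⊆ Ω :=
    prod_mono (fun τ hτ => ⟨hτ.1.le, hτ.2.trans_le ht⟩) Subset.rfl
  -- the moderator term is jointly a.e.-measurable (continuous on the slab)
  have hmod : AEMeasurable (fun z : ℝ × EuclideanSpace ℝ (Fin 3) => Φ z.1 ‖uncurry u z‖)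
      ((volume.restrict (Ioo 0 t)).prod (volume : Measure (EuclideanSpace ℝ (Fin 3)))) := by
    rw [levelSetModeration_prod_restrict_Ioo]
    refine ContinuousOn.aemeasurable ?_ (measurableSet_Ioo.prod MeasurableSet.univ)
    have h1 : ContinuousOn (fun z : ℝ × EuclideanSpace ℝ (Fin 3) => (z.1, ‖uncurry u z‖))
        (Ioo 0 t ×ˢ univ) :=
      continuous_fst.continuousOn.prodMk (hcontu.mono hsub).norm
    exact hΦ.comp_continuousOn h1
  set G : ℝ × EuclideanSpace ℝ (Fin 3) → ℝ≥0∞ := fun z =>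
    ENNReal.ofReal ((uncurry q z - Φ z.1 ‖uncurry u z‖) ^ 2) with hG
  have hGm : AEMeasurable G
      ((volume.restrict (Ioo 0 t)).prod (volume : Measure (EuclideanSpace ℝ (Fin 3)))) :=
    ENNReal.measurable_ofReal.comp_aemeasurable ((hq.sub hmod).pow_const 2)
  have hΨ : AEMeasurable (W.indicator G)
      ((volume.restrict (Ioo 0 t)).prod (volume : Measure (EuclideanSpace ℝ (Fin 3)))) :=
    hGm.indicator hWmeas
  refine (hΨ.lintegral_prod_right').congr ?_
  filter_upwards [ae_restrict_mem measurableSet_Ioo] with τ hτ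
  have hτ' : τ ∈ Ico 0 T := ⟨hτ.1.le, hτ.2.trans_le ht⟩
  refine lintegral_congr fun x => ?_
  by_cases hx : c < ‖u τ x‖
  · have hzW : (τ, x) ∈ W := ⟨mk_mem_prod hτ' (mem_univ x), hx⟩
    rw [indicator_of_mem hzW, indicator_of_mem (show x ∈ {x | c < ‖u τ x‖} from hx)]
    rfl
  · have hzW : (τ, x) ∉ W := fun h => hx h.2
    rw [indicator_of_notMem hzW, indicator_of_notMem (show x ∉ {x | c < ‖u τ x‖} from hx)]

/-- **Time-measurability of the level-set dissipation slice** (explicit form of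
`levelSetModeration_aemeasurable_dissipationSlice`, registered sub-goal of the crux item).
[folklore] -/
theorem levelSetModeration_aemeasurableDissipationSlice :
    ∀ (T : ℝ) (u : ℝ → EuclideanSpace ℝ (Fin 3) → EuclideanSpace ℝ (Fin 3)) (c t : ℝ), Literature.Analysis.FluidPDE.IsSmoothSpaceTimeOn (Set.Ico 0 T) u → 0 < c → t ≤ T → AEMeasurable (fun τ => ∫⁻ x, Set.indicator {x | c < ‖u τ x‖} (fun x => ENNReal.ofReal (‖fderiv ℝ (fun y => ‖u τ y‖) x‖ ^ 2)) x) (MeasureTheory.volume.restrict (Set.Ioo 0 t)) :=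
  fun _ _ _ _ hu hc ht => levelSetModeration_aemeasurable_dissipationSlice hu hc ht

end Summit.NavierStokesRegularity.NavierStokesRegularity.Theorems
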